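import Summits.BirchSwinnertonDyer.Rank1Residual.ManinAdditive.CuspThreeTorsionAtFour
import HarnessLib

/-!
# Placement edges for the candidates E-an-45 / E-an-45′ / E-an-46 / E-an-46′ (`CuspThreeTorsionAtFour.lean`) —
# cell `bsd-f2-manin`, planner an g11 (MEMO-an §55), refuter-1 §R46

Theorem-only sibling of the `@[conjecture]` leaf. PROVED here (nothing new asserted):

* `threeDvdModularDegreeAtFourExact_of_cuspImageZero` — an's glue (HOME/an/Sketch-an-g11.lean 3b526052f38cd08e
  `threeDvdModularDegreeAtFourExact_of`) with the rationality hypothesis typed as an IMPLICATION per refuter-1 §R46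
  rb1 («the `∃ P, ((3 • P = 0 → P = 0) → X)` encoding ⟺ `(∀ P, 3 • P = 0 → P = 0) → X` — type it as the
  implication»): E-an-46 (geometric) + «no rational `3`-torsion ⟹ the cusp `1/M` maps to `O`» ⟹ E-an-46′
  (torsion form). The middle hypothesis is E-an-45′ combined with the rationality of the cusp image `φ_D([1/M])`
  (a theorem for every datum per refuter-1 §R46 (6): `φ_D^σ − φ_D` kills `ω_W` and fixes `∞`), which the leaf
  cannot express on `D.uniformize` (values in `W(ℂ)`); a typed rationality clause would read
  `∃ P : W.toAffine.Point, 3 • P = 0 ∧ D.uniformize (c·{∞,1/M}) = Affine.Point.map (Algebra.ofId ℚ ℂ) P` — left to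
  the planner/prover (not a cell row at filing).
* `threeDvdModularDegreeAtFourExact_of_exists` — an's original `∃`-encoded glue VERBATIM (kept for by-name
  compatibility with the sketch), derived from the implication form.
* `cuspImageZero_hyp_of_exists` / the equivalence of the two encodings (refuter-1 rb1), proved.

Nothing about BSD or the Manin constant is asserted or proved here (an §55.5: the package is Manin-neutral).
-/

set_option autoImplicit false

noncomputable section

open scoped MatrixGroups ModularForm

open CongruenceSubgroup WeierstrassCurve
  Literature.NumberTheory.EllipticCurves Literature.NumberTheory.EllipticCurves.ModularForms

namespace Summit.BirchSwinnertonDyer.Rank1Residual.ManinAdditive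

/-- **E-an-46 ⟹ E-an-46′ given «no rational 3-torsion ⟹ cusp image zero»** (an's glue with the rationality
hypothesis in implication form, refuter-1 §R46 rb1). [folklore] -/
theorem threeDvdModularDegreeAtFourExact_of_cuspImageZero
    (hgeo : ThreeDvdModularDegreeOfCuspImageZero)
    (hrat : ∀ (W : WeierstrassCurve ℚ) [W.IsElliptic] {M : ℕ} [NeZero (4 * M)], Odd M →
      ∀ D : ModularParametrizationData W (4 * M),
        (∀ P : W.toAffine.Point, 3 • P = 0 → P = 0) →
          D.uniformize ((D.c : ℂ) * modularSymbol D.f (1 / (M : ℚ))) = 0) :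
    ThreeDvdModularDegreeAtFourExact := by
  intro W _ M _ hM hnt D
  exact hgeo W hM D (hrat W hM D hnt)

/-- The two encodings of the rationality hypothesis agree (refuter-1 §R46 rb1): an's
`∃ P, ((3 • P = 0 → P = 0) → X)` is equivalent to `(∀ P, 3 • P = 0 → P = 0) → X` (the point type is inhabited
by `0`). [folklore] -/
theorem exists_imp_iff_forall_imp {W : WeierstrassCurve ℚ} (X : Prop) :
    (∃ P : W.toAffine.Point, ((3 • P = 0 → P = 0) → X)) ↔ ((∀ P : W.toAffine.Point, 3 • P = 0 → P = 0) → X) := by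
  constructor
  · rintro ⟨P, hP⟩ h
    exact hP (h P)
  · intro h
    by_cases hX : X
    · exact ⟨0, fun _ => hX⟩
    · have hnot : ¬ ∀ P : W.toAffine.Point, 3 • P = 0 → P = 0 := fun hall => hX (h hall)
      obtain ⟨P, hP⟩ := not_forall.mp hnot
      obtain ⟨hP3, hPne⟩ := Classical.not_imp.mp hP
      exact ⟨P, fun himp => absurd (himp hP3) hPne⟩

/-- **an's original glue, `∃`-encoded hypothesis VERBATIM** (HOME/an/Sketch-an-g11.lean 3b526052f38cd08e
`threeDvdModularDegreeAtFourExact_of`), now a corollary of the implication form. [folklore] -/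
theorem threeDvdModularDegreeAtFourExact_of_exists
    (hgeo : ThreeDvdModularDegreeOfCuspImageZero)
    (hrat : ∀ (W : WeierstrassCurve ℚ) [W.IsElliptic] {M : ℕ} [NeZero (4 * M)], Odd M →
      ∀ D : ModularParametrizationData W (4 * M),
        ∃ P : W.toAffine.Point, (3 • P = 0 → P = 0) →
          D.uniformize ((D.c : ℂ) * modularSymbol D.f (1 / (M : ℚ))) = 0) :
    ThreeDvdModularDegreeAtFourExact :=
  threeDvdModularDegreeAtFourExact_of_cuspImageZero hgeo
    (fun W _ _ _ hM D => (exists_imp_iff_forall_imp _).1 (hrat W hM D))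

/-- **E-an-45′ is c-scaled E-an-45 for any datum**: if `3·{∞,1/M}_f ∈ Λ_f` (first clause of E-an-45 for `D.f`)
then `3 · φ_D([1/M]) = O`, because `c·Λ_f ⊆ Λ_W = ker (uniformize)` (`D.smul_periodLattice_le`,
`D.uniformize_eq_zero_iff`; refuter-1 §R46 (4)). [folklore] -/
theorem cuspImage_three_torsion_of_symbol {W : WeierstrassCurve ℚ} {M : ℕ} [NeZero (4 * M)]
    (D : ModularParametrizationData W (4 * M))
    (h : 3 * modularSymbol D.f (1 / (M : ℚ)) ∈ periodLattice D.f) :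
    3 • D.uniformize ((D.c : ℂ) * modularSymbol D.f (1 / (M : ℚ))) = 0 := by
  rw [← map_nsmul, D.uniformize_eq_zero_iff, nsmul_eq_mul]
  have := D.smul_periodLattice_le _ h
  convert this using 1
  push_cast
  ring

end Summit.BirchSwinnertonDyer.Rank1Residual.ManinAdditive

end
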